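import Summits.BirchSwinnertonDyer.BirchSwinnertonDyer.Theorems.AdditiveBranchIMCGordTwoTwistedReciprocityKronecker
import Summits.BirchSwinnertonDyer.BirchSwinnertonDyer.Theorems.AdditiveBranchIMCTwistAtTwoAtkinLehnerInvariance
import HarnessLib

/-!
# The twisted Wan road (crux 19357, line `three_field_road`), design D2 at an ADDITIVE TWIST-TYPE `2`: the reciprocity identity with EVEN
# exponents and the parity of `f₂` (LEAD g18, door A2 «additive `2` on E3′ rows» of LeadReport26 §4)

Theorems only, no definition, no named fact, no `sorry`. Design D2's reciprocity identity `prod_engineKronecker_eq_jacobiSym` (p812737) asks that every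
exponent of the conductor be `1` or `2`; on the E3′ rows with an additive twist-type `2` the partner `V` has `f₂(V) ∈ {4, 6}` (Barrios et al. 2025
Thm. 5.1: `V ≅ W₁^{(t)}`, `W₁` semistable at `2`, `t ∈ {−1, 2, −2}`). Since `(r/p)^{f} = 1` for every EVEN `f`, the identity holds verbatim under
the weaker hypothesis «every exponent is `1` or even»:

  `∏_{r ∈ N.primeFactors ∖ {q}} [f_r = 1] k_r(D′) = (N/p)`,  `k_2 = χ₈`, `k_r = (D′/r)` at odd `r`.

* `jacobiSym_natCast_eq_prod_primeFactors_even`, `prod_engineKronecker_eq_jacobiSym_even` — the identity;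
* `conductorExponent_two_eq_of_twistType_two` — `f₂(E) = 4` (`t = −1`) or `6` (`t = ±2`) at a twist-type additive `2`; `even_conductorExponent_two_of_twistType_two`.

References: [IrelandRosen1990] Ch. 5 §2; [BarriosEtAl2025] Thm. 5.1; [SilvermanAEC2009] X.5 Cor. 5.4. BSD is proved for no curve by any of this.
-/

set_option linter.dupNamespace false
set_option autoImplicit false

open scoped Classical

namespace Summit.BirchSwinnertonDyer.BirchSwinnertonDyer.Theorems.TwistedWanRoad

open NumberTheorySymbols

/-! ### §1 The reciprocity identity with even exponents -/

/-- `(N / p) = ∏_{r ∣ N, f_r = 1} (r / p)` for `p ∤ N` prime when every exponent of `N` is `1` or EVEN (`(r/p)^{2k} = 1`).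
[cite: IrelandRosen1990, Ch. 5 §2 Prop. 5.2.2] -/
theorem jacobiSym_natCast_eq_prod_primeFactors_even {N p : ℕ} (hp : p.Prime) (hN0 : N ≠ 0) (hpN : ¬ p ∣ N)
    (hf : ∀ r ∈ N.primeFactors, N.factorization r = 1 ∨ Even (N.factorization r)) :
    J((N : ℤ) | p) = ∏ r ∈ N.primeFactors, (if N.factorization r = 1 then J((r : ℤ) | p) else 1) := by
  have hprod : (N : ℤ) = ∏ r ∈ N.primeFactors, ((r : ℤ) ^ (N.factorization r)) := by
    conv_lhs => rw [← Nat.prod_factorization_pow_eq_self hN0]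
    rw [Finsupp.prod, Nat.support_factorization]
    push_cast
    rfl
  let φ : ℤ →* ℤ :=
    { toFun := fun a ↦ J(a | p), map_one' := jacobiSym.one_left p, map_mul' := fun a b ↦ jacobiSym.mul_left a b p }
  have hφ : ∀ a, J(a | p) = φ a := fun _ ↦ rfl
  rw [hprod, hφ, map_prod]
  refine Finset.prod_congr rfl (fun r hr ↦ ?_)
  have hr' := Nat.mem_primeFactors.mp hr
  have hrp : ¬ (p : ℤ) ∣ (r : ℤ) := by
    intro h
    have h' : p ∣ r := by exact_mod_cast h
    have hpr : p = r := (Nat.prime_dvd_prime_iff_eq hp hr'.1).mp h'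
    exact hpN (hpr ▸ hr'.2.1)
  rw [← hφ, jacobiSym.pow_left]
  rcases hf r hr with h1 | ⟨k, hk⟩
  · rw [h1, if_pos rfl, pow_one]
  · have hne : N.factorization r ≠ 1 := by rw [hk]; omega
    rw [if_neg hne, hk, ← two_mul, pow_mul, sq, ThreeFieldRoadSupply.jacobiSym_mul_self_eq_one hp hrp, one_pow]

/-- **The reciprocity identity of design D2, Kronecker form, EVEN exponents allowed** (module docstring): for `p ∤ N` an odd prime, every exponent
of `N` equal to `1` or even, `f_q ≠ 1`, `(D/r) = (p*/r)` at the odd `r ∥ N` other than `q`, and `χ₈(D) = (2/p)` if `2 ∥ N`: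
`∏_{r ∈ N.primeFactors ∖ {q}} [f_r = 1] k_r(D) = (N/p)` with `k_2 = χ₈(D)`, `k_r = (D/r)` for odd `r`. [cite: IrelandRosen1990, Ch. 5 §2] -/
theorem prod_engineKronecker_eq_jacobiSym_even {N p q : ℕ} {D : ℤ} (hp : p.Prime) (hp2 : p ≠ 2) (hN0 : N ≠ 0) (hpN : ¬ p ∣ N)
    (hf : ∀ r ∈ N.primeFactors, N.factorization r = 1 ∨ Even (N.factorization r))
    (hq : N.factorization q ≠ 1)
    (hD : ∀ r ∈ N.primeFactors, r ≠ 2 → r ≠ q → N.factorization r = 1 →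
      J(D | r) = J(((-1 : ℤ) ^ (p / 2) * p) | r))
    (hD2 : 2 ∈ N.primeFactors → N.factorization 2 = 1 → ZMod.χ₈ (D : ZMod 8) = J(2 | p)) :
    (∏ r ∈ N.primeFactors.erase q,
        (if N.factorization r = 1 then (if r = 2 then ZMod.χ₈ (D : ZMod 8) else J(D | r)) else 1)) = J((N : ℤ) | p) := by
  rw [jacobiSym_natCast_eq_prod_primeFactors_even hp hN0 hpN hf,
    ← Finset.prod_erase N.primeFactors (f := fun r ↦ if N.factorization r = 1 then J((r : ℤ) | p) else 1)
      (a := q) (by simp only [hq, if_false])]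
  refine Finset.prod_congr rfl (fun r hr ↦ ?_)
  obtain ⟨hrq, hrN⟩ := Finset.mem_erase.mp hr
  by_cases h1 : N.factorization r = 1
  · simp only [h1, if_true]
    by_cases hr2 : r = 2
    · subst hr2
      rw [if_pos rfl, hD2 hrN h1, Nat.cast_ofNat]
    · rw [if_neg hr2, hD r hrN hr2 hrq h1, jacobiSym_pStar_eq_swap hp (Nat.prime_of_mem_primeFactors hrN) hp2 hr2]
  · simp only [h1, if_false]

end Summit.BirchSwinnertonDyer.BirchSwinnertonDyer.Theorems.TwistedWanRoad

/-! ### §2 `f₂ ∈ {4, 6}` at a twist-type additive `2` -/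

noncomputable section

namespace Summit.BirchSwinnertonDyer.BirchSwinnertonDyer.Theorems.TwistRootNumberTwisted

open Literature.NumberTheory.EllipticCurves IsDedekindDomain IsDedekindDomain.HeightOneSpectrum Rat.HeightOneSpectrum WeierstrassCurve

variable (W : WeierstrassCurve ℚ) [W.IsElliptic]

/-- **`f₂(E) = 4` or `6` at a twist-type additive `2`**: if `E` is additive at `2` and `E^{(t)}` is not, `t ∈ {−1, 2, −2}`, then `f₂(E) = 4` for
`t = −1` and `f₂(E) = 6` for `t = ±2` (`E ≅ (E^{(t)})^{(t)}`, Barrios et al. Thm. 5.1 at the semistable `2` of `E^{(t)}`).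
[cite: BarriosEtAl2025, Thm. 5.1] [cite: SilvermanAEC2009, X.5 Cor. 5.4] -/
theorem conductorExponent_two_eq_of_twistType_two {t : ℤ} (ht : t = -1 ∨ t = 2 ∨ t = -2)
    (hnt : ¬ (W.quadraticTwist (t : ℚ)).HasAdditiveReductionAt ((primesEquiv (R := ℤ)).symm ⟨2, Nat.prime_two⟩)) :
    W.conductorExponent ((primesEquiv (R := ℤ)).symm ⟨2, Nat.prime_two⟩) = if t = -1 then 4 else 6 := by
  have ht0 : t ≠ 0 := by rcases ht with rfl | rfl | rfl <;> norm_num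
  have htQ : (t : ℚ) ≠ 0 := by exact_mod_cast ht0
  set v : HeightOneSpectrum ℤ := (primesEquiv (R := ℤ)).symm ⟨2, Nat.prime_two⟩ with hv
  have hv2 : natGenerator v = 2 := by rw [hv, Rat.natGenerator_primesEquiv_symm]
  set W₁ := W.quadraticTwist (t : ℚ) with hW₁
  haveI : W₁.IsElliptic := W.isElliptic_quadraticTwist htQ
  obtain ⟨C, hC⟩ := W.exists_variableChange_smul_eq_quadraticTwist_sq (θ := (t : ℚ)) htQ
  have hE : W₁.quadraticTwist (t : ℚ) = C • W := by rw [hW₁, quadraticTwist_quadraticTwist, hC, sq]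
  haveI : (W₁.quadraticTwist (t : ℚ)).IsElliptic := by rw [hE]; infer_instance
  have hf₁ : W₁.conductorExponent v ≤ 1 := by
    by_contra h
    exact hnt ((two_le_conductorExponent_iff_holds v W₁).mp (by omega))
  have key := BarriosEtAl2025.conductorExponent_quadraticTwist_two_of_le_one_holds W₁ v hv2 hf₁ t
  have hfE_eq : W.conductorExponent v = (W₁.quadraticTwist (t : ℚ)).conductorExponent v := by
    rw [hE, conductorExponent_smul' v W C]
  rw [hfE_eq]
  rcases ht with rfl | rfl | rfl
  · rw [if_pos rfl]; exact key.1 (by decide)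
  · rw [if_neg (by norm_num)]; exact key.2 (by decide)
  · rw [if_neg (by norm_num)]; exact key.2 (by decide)

/-- **`f₂(E)` is EVEN at a twist-type additive `2`** (`4` or `6`). [cite: BarriosEtAl2025, Thm. 5.1] -/
theorem even_conductorExponent_two_of_twistType_two {t : ℤ} (ht : t = -1 ∨ t = 2 ∨ t = -2)
    (hnt : ¬ (W.quadraticTwist (t : ℚ)).HasAdditiveReductionAt ((primesEquiv (R := ℤ)).symm ⟨2, Nat.prime_two⟩)) :
    Even (W.conductorExponent ((primesEquiv (R := ℤ)).symm ⟨2, Nat.prime_two⟩)) := by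
  rw [conductorExponent_two_eq_of_twistType_two W ht hnt]
  split_ifs
  · exact ⟨2, rfl⟩
  · exact ⟨3, rfl⟩

end Summit.BirchSwinnertonDyer.BirchSwinnertonDyer.Theorems.TwistRootNumberTwisted

end
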